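import Literature.Probability.RandomPlanarGeometry.HullDecomposition
import Literature.Probability.RandomPlanarGeometry.HullApproximation
import Literature.Topology.PlaneTopology.HalfPlaneEnclosure
import Literature.Topology.PlaneTopology.JordanCurveProofs
import HarnessLib

/-!
# Crux `SAWDevelopingMap.ObservableToSLE` (stmt-CriticalPhenomena-10472), line
`floor-ratio-restriction-bootstrap`: components of a far hull do not arch over near points
(helper for STUB 4b)

Landing target:
`Summits/CriticalPhenomena/SAWScalingLimit/Theorems/SAWDevelopingMapObservableToSLEHullApproxClusterA.lean`
(`--supports stmt-CriticalPhenomena-10472`).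

Setting of the "hull approximation from outside" (STUB 4b, `stub_hullApproxDomain`): `A ∈ 𝒬*`,
`F = cl(ℍ ∖ A)`, and `B ∈ 𝒬*` a hull all of whose points are at distance `≥ r > 0` from `F`.
The clusters of `B` are formed along the real axis: the real trace of `B` lies in the open set
`Z' = {x ∈ ℝ : dist(x, F) > r/2}`, and the main lemma of this file
(`stub_hullApproxDomain_noArch`) says that **a connected component of `B` cannot contain real
points on both sides of a point of `ℝ ∖ Z'`**: by the enclosure theorem
(`JordanCurveTheorem.exists_isBounded_connectedComponentIn`, from the Jordan curve theorem) the
component would enclose the points of `ℍ` just above such a point `z`, but these are joined to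
the unbounded connected set `ℍ ∖ A ⊆ ℍ ∖ B` by a short segment towards a point of `ℍ ∖ A` near
`z`. Consequently all real points of one component of `B` lie in a single component of `Z'`
(`real_mem_component_of_component`).

* `mem_connectedComponentIn_of_mem_closure` — a point of an open `U ⊆ ℝ` in the closure of a
  component of `U` lies in that component;
* `stub_hullApproxDomain_noArch` — the no-arch lemma (registered sub-goal of STUB 4b);
* `real_mem_component_of_component` — real points of a component of `B` lie in one component
  of `Z'`.
-/

noncomputable section

open Set Filter Topology Metric Complex Function Bornology
open Literature.Probability.RandomPlanarGeometry
open Literature.Topology.PlaneTopology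
open UpperHalfPlane (upperHalfPlaneSet isOpen_upperHalfPlaneSet)

namespace Summit.CriticalPhenomena.SAWScalingLimit.Theorems.ObservableToSLE.FloorRatio

/-- In an open subset `U` of `ℝ`, a point of `U` in the closure of a component of `U` belongs
to that component (components of open sets of `ℝ` are open). [folklore] -/
theorem mem_connectedComponentIn_of_mem_closure {U : Set ℝ} (hU : IsOpen U) {x y : ℝ}
    (hy : y ∈ closure (connectedComponentIn U x)) (hyU : y ∈ U) :
    y ∈ connectedComponentIn U x := by
  obtain ⟨δ, hδ, hball⟩ := Metric.isOpen_iff.1 hU y hyU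
  obtain ⟨w, hwb, hwc⟩ := Metric.mem_closure_iff.1 hy δ hδ
  have hwball : w ∈ ball y δ := by rw [mem_ball, dist_comm]; exact hwc
  have hsub : ball y δ ⊆ connectedComponentIn U w :=
    (convex_ball y δ).isPreconnected.subset_connectedComponentIn hwball hball
  rw [connectedComponentIn_eq hwb]
  exact hsub (mem_ball_self hδ)

variable {A B : Set ℂ} {r : ℝ}

/-- Points of `ℍ ∖ A` are not in the far hull `B`. [folklore] -/
theorem notMem_of_mem_diff (hr : 0 < r)
    (hfar : ∀ w ∈ B, r ≤ infDist w (closure (upperHalfPlaneSet \ A))) {w : ℂ}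
    (hw : w ∈ upperHalfPlaneSet \ A) : w ∉ B := fun hwB ↦ by
  have h0 : infDist w (closure (upperHalfPlaneSet \ A)) = 0 := infDist_zero_of_mem (subset_closure hw)
  have := hfar w hwB
  linarith

/-- `ℍ ∖ A` is unbounded for a bounded `A`. [folklore] -/
theorem not_isBounded_diff (hA : IsBounded A) : ¬ IsBounded (upperHalfPlaneSet \ A) := by
  intro hb
  obtain ⟨R, hR⟩ := hA.subset_closedBall 0
  obtain ⟨M, hM⟩ := hb.subset_closedBall 0
  set y : ℂ := ((|R| + |M| + 1 : ℝ) : ℂ) * I with hy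
  have hyn : ‖y‖ = |R| + |M| + 1 := by
    rw [hy, norm_mul, norm_real, norm_I, mul_one, Real.norm_of_nonneg (by positivity)]
  have hyH : y ∈ upperHalfPlaneSet := by
    show 0 < y.im
    simp only [hy, mul_im, ofReal_re, I_im, mul_one, ofReal_im, I_re, mul_zero, add_zero]
    positivity
  have hyA : y ∉ A := fun h ↦ by
    have := hR h
    rw [mem_closedBall, dist_zero_right, hyn] at this
    linarith [le_abs_self R, abs_nonneg M]
  have := hM ⟨hyH, hyA⟩
  rw [mem_closedBall, dist_zero_right, hyn] at this
  linarith [le_abs_self M, abs_nonneg R]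

/-- **No arch over a near point.** Let `A ∈ 𝒬*`, `F = cl(ℍ ∖ A)`, and let `B ∈ 𝒬*` have all its
points at distance `≥ r > 0` from `F`. If a connected component of `B` contains the real points
`y₁ ≤ y₂`, then every real `z ∈ [y₁, y₂]` is at distance `> r/2` from `F`: otherwise a point of
`ℍ ∖ A` lies within `r` of `z`, the segment from `z` to it misses `B`, and the points of `ℍ` just
above `z` would be joined to the unbounded connected set `ℍ ∖ A ⊆ ℍ ∖ B`, contradicting the
enclosure theorem for the component (Jordan curve theorem). Registered sub-goal
`stub_hullApproxDomain_noArch` of STUB 4b (`stub_hullApproxDomain`). [folklore] -/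
theorem stub_hullApproxDomain_noArch :
    ∀ (A B : Set ℂ) (r : ℝ) (b : ℂ) (y₁ y₂ z : ℝ), IsStarHull A → IsStarHull B → 0 < r →
      (∀ w ∈ B, r ≤ infDist w (closure (upperHalfPlaneSet \ A))) →
      ((y₁ : ℂ) ∈ connectedComponentIn B b) → ((y₂ : ℂ) ∈ connectedComponentIn B b) →
      y₁ ≤ z → z ≤ y₂ → r / 2 < infDist (z : ℂ) (closure (upperHalfPlaneSet \ A)) := by
  intro A B r b y₁ y₂ z hA hB hr hfar hy₁ hy₂ hz₁ hz₂
  set F : Set ℂ := closure (upperHalfPlaneSet \ A) with hF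
  set K : Set ℂ := connectedComponentIn B b with hK
  have hKB : K ⊆ B := connectedComponentIn_subset _ _
  have hBc : IsClosed B := hB.isBoundedHull.isClosed
  by_contra hle
  push Not at hle
  -- `z` is strictly between `y₁` and `y₂`, and not in `K`
  have hzB : (z : ℂ) ∉ B := fun h ↦ by linarith [hfar _ h]
  have hy₁z : y₁ < z := lt_of_le_of_ne hz₁ fun h ↦ hzB (by rw [← h]; exact hKB hy₁)
  have hzy₂ : z < y₂ := lt_of_le_of_ne hz₂ fun h ↦ hzB (by rw [h]; exact hKB hy₂)
  -- a point `f'` of `ℍ ∖ A` within `r` of `z`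
  have hFne : F.Nonempty := ⟨0, hA.zero_mem_closure_diff⟩
  obtain ⟨f, hfF, hzf⟩ := (infDist_lt_iff hFne).1 (hle.trans_lt (by linarith : r / 2 < r))
  obtain ⟨f', hf', hff'⟩ := Metric.mem_closure_iff.1 hfF (r - dist (z : ℂ) f) (by linarith)
  have hzf' : dist (z : ℂ) f' < r := by linarith [dist_triangle (z : ℂ) f f']
  have hf'H : 0 < f'.im := hf'.1
  -- the segment from `z` towards `f'`
  set p : ℝ → ℂ := fun u ↦ (z : ℂ) + u * (f' - z) with hp
  have hpc : Continuous p := by rw [hp]; fun_prop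
  have hp1 : p 1 = f' := by simp [hp]
  have hpim : ∀ u, (p u).im = u * f'.im := fun u ↦ by simp [hp]
  have hpdist : ∀ u, dist (p u) f' = |1 - u| * dist (z : ℂ) f' := fun u ↦ by
    rw [dist_eq_norm, dist_eq_norm, show p u - f' = ((1 - u : ℝ) : ℂ) * ((z : ℂ) - f') by
      rw [hp]; push_cast; ring, norm_mul, norm_real, Real.norm_eq_abs]
  have hpdistz : ∀ u, dist (p u) z = |u| * dist (z : ℂ) f' := fun u ↦ by
    rw [dist_eq_norm, dist_comm, dist_eq_norm, show p u - z = (u : ℂ) * (f' - z) by rw [hp]; ring,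
      norm_mul, norm_real, Real.norm_eq_abs, ← norm_neg (f' - z), neg_sub]
  have hpB : ∀ u ∈ Icc (0 : ℝ) 1, p u ∉ B := by
    intro u hu hpu
    have h1 : infDist (p u) F ≤ dist (p u) f' := infDist_le_dist_of_mem (subset_closure hf')
    have h2 : dist (p u) f' ≤ dist (z : ℂ) f' := by
      rw [hpdist, abs_of_nonneg (by linarith [hu.2])]
      nlinarith [hu.1, dist_nonneg (x := (z : ℂ)) (y := f')]
    linarith [hfar _ hpu]
  -- the enclosure theorem for the component `K`
  have hKc : IsCompact K :=
    hB.isBoundedHull.isCompact.of_isClosed_subset (isClosed_connectedComponentIn_of_isClosed hBc b) hKB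
  have hKim : ∀ w ∈ K, 0 ≤ w.im := fun w hw ↦ hB.isBoundedHull.im_nonneg (hKB hw)
  obtain ⟨ρ, hρ, henc⟩ := JordanCurveTheorem_holds.exists_isBounded_connectedComponentIn hKc
    isPreconnected_connectedComponentIn hKim hy₁z hzy₂ hy₁ hy₂ (fun h ↦ hzB (hKB h))
  -- a point of the segment close to `z`
  have hd0 : 0 < dist (z : ℂ) f' := dist_pos.2 fun h ↦ by
    have : (f' : ℂ).im = 0 := by rw [← h]; simp
    linarith
  set u₀ : ℝ := min (1 / 2) (ρ / (2 * dist (z : ℂ) f')) with hu₀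
  have hu₀pos : 0 < u₀ := lt_min (by norm_num) (by positivity)
  have hu₀le : u₀ ≤ 1 / 2 := min_le_left _ _
  have hu₀ball : p u₀ ∈ ball (z : ℂ) ρ := by
    rw [mem_ball, hpdistz, abs_of_pos hu₀pos]
    have h1 : u₀ * dist (z : ℂ) f' ≤ ρ / (2 * dist (z : ℂ) f') * dist (z : ℂ) f' :=
      mul_le_mul_of_nonneg_right (min_le_right _ _) dist_nonneg
    have h2 : ρ / (2 * dist (z : ℂ) f') * dist (z : ℂ) f' = ρ / 2 := by
      field_simp
    linarith
  have hu₀im : 0 < (p u₀).im := by rw [hpim]; positivity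
  have hbdd := henc (p u₀) hu₀ball hu₀im
  -- but the component of `p u₀` in `ℍ ∖ K` contains the unbounded `ℍ ∖ A`
  set U₀ : Set ℂ := upperHalfPlaneSet \ K with hU₀
  have hseg : p '' Icc u₀ 1 ⊆ U₀ := by
    rintro _ ⟨u, hu, rfl⟩
    refine ⟨?_, fun h ↦ hpB u ⟨hu₀pos.le.trans hu.1, hu.2⟩ (hKB h)⟩
    show 0 < (p u).im
    rw [hpim]
    exact mul_pos (hu₀pos.trans_le hu.1) hf'H
  have hdiffU₀ : upperHalfPlaneSet \ A ⊆ U₀ := fun w hw ↦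
    ⟨hw.1, fun h ↦ notMem_of_mem_diff hr hfar hw (hKB h)⟩
  have hsegc : IsPreconnected (p '' Icc u₀ 1) := isPreconnected_Icc.image p hpc.continuousOn
  have hcomp1 : p '' Icc u₀ 1 ⊆ connectedComponentIn U₀ (p u₀) :=
    hsegc.subset_connectedComponentIn ⟨u₀, ⟨le_rfl, by linarith⟩, rfl⟩ hseg
  have hf'comp : f' ∈ connectedComponentIn U₀ (p u₀) := hcomp1 ⟨1, ⟨by linarith, le_rfl⟩, hp1⟩
  have hcomp2 : upperHalfPlaneSet \ A ⊆ connectedComponentIn U₀ (p u₀) := by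
    have h := hA.isBoundedHull.2.2.isPathConnected.isConnected.isPreconnected.subset_connectedComponentIn
      hf' hdiffU₀
    rwa [← connectedComponentIn_eq hf'comp] at h
  exact not_isBounded_diff hA.isBoundedHull.1 (hbdd.subset hcomp2)

/-- **Real points of one component of `B` lie in one component of the far set
`Z' = {x : dist(x, F) > r/2}`** (from `stub_hullApproxDomain_noArch`: the whole real interval
between two such points lies in `Z'`). [folklore] -/
theorem real_mem_component_of_component (hA : IsStarHull A) (hB : IsStarHull B) (hr : 0 < r)
    (hfar : ∀ w ∈ B, r ≤ infDist w (closure (upperHalfPlaneSet \ A))) {b : ℂ} {y y' : ℝ}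
    (hy : (y : ℂ) ∈ connectedComponentIn B b) (hy' : (y' : ℂ) ∈ connectedComponentIn B b) :
    y' ∈ connectedComponentIn {x : ℝ | r / 2 < infDist (x : ℂ) (closure (upperHalfPlaneSet \ A))} y := by
  have hsub : uIcc y y' ⊆ {x : ℝ | r / 2 < infDist (x : ℂ) (closure (upperHalfPlaneSet \ A))} := by
    intro z hz
    rcases le_total y y' with h | h
    · rw [uIcc_of_le h] at hz
      exact stub_hullApproxDomain_noArch A B r b y y' z hA hB hr hfar hy hy' hz.1 hz.2
    · rw [uIcc_of_ge h] at hz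
      exact stub_hullApproxDomain_noArch A B r b y' y z hA hB hr hfar hy' hy hz.1 hz.2
  exact isPreconnected_uIcc.subset_connectedComponentIn left_mem_uIcc hsub right_mem_uIcc

end Summit.CriticalPhenomena.SAWScalingLimit.Theorems.ObservableToSLE.FloorRatio

end
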